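import Summits.CriticalPhenomena.PercolationContinuityZ3.Theorems.PercNearOneGluingNoHeavyLowerTailFKHullPortHtwWorld
import Summits.CriticalPhenomena.PercolationContinuityZ3.Theorems.PercNearOneGluingNoHeavyLowerTailFKCSHHpart
import HarnessLib

/-!
# FK sub-lane: (Htw)_FK HOLDS — `FK.HtwFK q` for every `q ≥ 1`; the FK finite leg hangs on `FK.PhiFKMonotone q` alone

Support file (`--supports stmt-CriticalPhenomena-4575`), FK sub-lane `prim-bschramm-fk-2` (gen 4); builds on p205010 (kernel theorem,
internal audit signed; external expert review pending).  No definitions, no named facts, no sorries; standard axioms.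

fk-1 gen 2 typed the two-source diagonal (Htw) for `φ_{w,q}` as the named statement `FK.HtwFK q` (`…FKCSHHpart.lean`, NOT asserted there)
and assembled `FK.additiveGluingFK_of_htwFK_of_phiFKMonotone : 1 ≤ q → PhiFKMonotone q → HtwFK q → AdditiveGluingFK q`.
fk-2 gen 3 proved (Htw) in world form for `φ_{𝐩,q}`, `q ≥ 1`, unconditionally: `FK.htw_world_rc` (`…FKHullPortHtwWorld.lean`, from
`FK.taQS_nonneg` = `T^S ≥ 0` by the second Bernstein deformation with base (★^H)_FK).  This file is the one-screen dictionary: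

* **`FK.htwFK_of_one_le : 1 ≤ q → FK.HtwFK q`** — `HtwFK` quantifies over NON-DEGENERATE parameter vectors (`0 < w e < 1`), so the
  side condition of `FK.htw_world_rc` ("weight-one pairs lie inside `Y`") is vacuous;
* **`FK.hpartFK_of_one_le : 1 ≤ q → FK.HpartFK q`** (Lemma H_FK, unconditional);
* **`FK.cshFK_of_phiFKMonotone : 1 ≤ q → FK.PhiFKMonotone q → FK.CSHFK q`** and
  **`FK.additiveGluingFK_of_phiFKMonotone : 1 ≤ q → FK.PhiFKMonotone q → FK.AdditiveGluingFK q`**,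
  `FK.nearOneGluingFK_of_phiFKMonotone` — Kozma–Nitzan's additive gluing (their Conj. 1 ⇒ Conj. 3 mechanism) for EVERY random-cluster
  measure `φ_{w,q}`, `q ≥ 1`, on every finite weighted graph, MODULO EXACTLY ONE named statement: Lemma Φ(b)_FK = `FK.PhiFKMonotone q`
  (monotonicity in `K` of the residual functional of the world-wise unfolding; open for `q > 1`, exact-census clean, bschramm/FK-DEFS.md §6).
`q = 1` regression: `example : AdditiveGluingFK 1` from `FK.phiFKMonotone_one`.
[cite: VandenbergHaggstromKahn2005, Thm. 1.4 (p. 7), §2.1 Lemma 2.3 (p. 10)] [cite: KozmaNitzan2024, Conj. 1 (p. 3), Conj. 4 (p. 32)]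
[cite: Grimmett2006, §1.4 eq. (1.20) (p. 15); Thm. (3.8)(b)]
-/

noncomputable section

namespace Summit.CriticalPhenomena.PercolationContinuityZ3.Theorems.FK

open MeasureTheory Set Literature.Probability.LatticeModels Literature.Probability.Percolation
open scoped Classical

/-- **(Htw)_FK holds for every `q ≥ 1`**: the named statement `FK.HtwFK q` of the FK finite leg (the two-source diagonal of the
conditioned slack hierarchy for `φ_{w,q}`, non-degenerate parameters) from fk-2 gen 3's unconditional world form `FK.htw_world_rc`
(`T^S ≥ 0`, second Bernstein deformation, base (★^H)_FK).  The weight-one side condition of `htw_world_rc` is vacuous because `w e < 1`.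
[cite: VandenbergHaggstromKahn2005, Thm. 1.4 (p. 7), §2.1 Lemma 2.3 (p. 10)] [cite: Gladkov2024, Thm. 3.2 (p. 4)] -/
theorem htwFK_of_one_le {q : ℝ} (hq : 1 ≤ q) : HtwFK q := by
  intro n w hw x Y S hxS o v hvS g hg _hg0
  have hINV : ∀ p : Sym2 (Fin n), ((w p : unitInterval) : ℝ) = 1 → ∀ u ∈ p, u ∈ Y := by
    intro p hp u _
    exfalso
    have hlt : w p < 1 := (hw p).2
    have hlt' : ((w p : unitInterval) : ℝ) < 1 := by exact_mod_cast hlt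
    exact absurd hp (ne_of_lt hlt')
  exact htw_world_rc w hq x Y S hxS o v hvS hINV g hg

/-- **Lemma H_FK holds for every `q ≥ 1`** (`FK.HpartFK q`, png-lead's Lemma H for `φ_{w,q}`): (K6)_rc in each world + (Htw)_FK.
[cite: VandenbergHaggstromKahn2005, Thm. 1.4 (p. 7)] -/
theorem hpartFK_of_one_le {q : ℝ} (hq : 1 ≤ q) : HpartFK q :=
  hpartFK_of_htwFK hq (htwFK_of_one_le hq)

/-- **The conditioned slack hierarchy for `φ_{w,q}` modulo Lemma Φ(b)_FK alone**: `1 ≤ q → PhiFKMonotone q → CSHFK q`.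
[cite: VandenbergHaggstromKahn2005, §2.1 (pp. 9–13)] [cite: KozmaNitzan2024, Conj. 4 (p. 32)] -/
theorem cshFK_of_phiFKMonotone {q : ℝ} (hq : 1 ≤ q) (hΦ : PhiFKMonotone q) : CSHFK q :=
  cshFK_of_htwFK_of_phiFKMonotone hq hΦ (htwFK_of_one_le hq)

/-- **FK ADDITIVE GLUING MODULO ONE NAMED STATEMENT**: `1 ≤ q → PhiFKMonotone q → AdditiveGluingFK q` — Kozma–Nitzan's additive gluing
for every random-cluster measure `φ_{w,q}`, `q ≥ 1`, on every finite weighted graph, reduced in Lean to Lemma Φ(b)_FK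
(`FK.PhiFKMonotone q`: the residual functional of the world-wise unfolding is increasing in the deleted vertex set).  NOTHING is asserted
about `PhiFKMonotone q` for `q ≠ 1`. [cite: KozmaNitzan2024, Conj. 1 (p. 3)] [cite: VandenbergHaggstromKahn2005, §2.1 (pp. 9–13)] -/
theorem additiveGluingFK_of_phiFKMonotone {q : ℝ} (hq : 1 ≤ q) (hΦ : PhiFKMonotone q) : AdditiveGluingFK q :=
  additiveGluingFK_of_htwFK_of_phiFKMonotone hq hΦ (htwFK_of_one_le hq)

/-- `FK.NearOneGluingFK q` (Kozma–Nitzan Conjecture 3 for `φ_{w,q}`) modulo `PhiFKMonotone q`, `q ≥ 1`.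
[cite: KozmaNitzan2024, Conj. 3 (p. 31)] -/
theorem nearOneGluingFK_of_phiFKMonotone {q : ℝ} (hq : 1 ≤ q) (hΦ : PhiFKMonotone q) : NearOneGluingFK q :=
  nearOneGluingFK_of_cshFK hq (cshFK_of_phiFKMonotone hq hΦ)

/-- `q = 1` regression through the one-hypothesis form: `AdditiveGluingFK 1` from `FK.phiFKMonotone_one` alone.
[cite: KozmaNitzan2024, Conj. 1 (p. 3)] -/
example : AdditiveGluingFK 1 := additiveGluingFK_of_phiFKMonotone le_rfl phiFKMonotone_one

end Summit.CriticalPhenomena.PercolationContinuityZ3.Theorems.FK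

end
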